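import Summits.BirchSwinnertonDyer.BirchSwinnertonDyer.Theorems.SignedBaseChangeAnticyclotomicEisensteinDivisibilityEisensteinTransferConverse
import HarnessLib

/-!
# Castella–Wan Thm. 6.8 for the `⊆` divisibilities up to `p^k` as an EQUIVALENCE on the crux's object
# `Castella2018.AcSelmer.XAc` (base change `W⁄K`): Form T ⟺ rational BDP Eisenstein inclusion

Lead seat bsd-line-sbc-p1 (gen 13), `--supports stmt-BirchSwinnertonDyer-20727` (crux
`AnticyclotomicEisensteinDivisibility`, line `bdpline`). Sequel of
`SignedBaseChangeAnticyclotomicEisensteinDivisibilityEisensteinTransferConverse` (the converse transfer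
(ii)`⊆` ⟹ (i)`⊆` in `Λ` and along one `j`) and of the forward file
`SignedBaseChangeAnticyclotomicEisensteinDivisibilityEisensteinTransfer` (p634573, (i)`⊆` ⟹ (ii)`⊆`): read on
`X_ac = AcSelmer.XAc (W⁄K) p κ 𝔭' ∅ γ` through `X.charIdeal_at_str_rel_eq_XAc_charIdeal`, in the currency
`signedHeegnerCharIdeal` of the registered research stub `stub_signedEisensteinSS_mult` (Form T). Result:
under the standing hypotheses of the transfer files (`TransferInputs … ε z L`, `loc_𝔭` injective on
`Sel_ε`, `X_ε` f.g. of rank one, `hEq`), **Form T `∃ k, (p^k)·char(X_{ε,tors}) ⊆ ι(char(Sel_ε/Λz))²` holds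
iff `∃ k, ∀ j compatible, (p^k)·Ch_Λ(X_ac)·R₀⟦T⟧ ⊆ (L)`** — the statement the cell asks to PROMOTE is
interchangeable with the rational BDP Eisenstein inclusion in Castella–Wan's (ii)-currency; with
`SignedBaseChangeAcDivTransferClassRigidity` (the class `z` is pinned by `L` up to `Λˣ`) it is a statement
about `X_ac` and `L` alone. All PROVED, standard axioms; no definition, no named fact, no `sorry`; BSD /
the crux are NOT proved by this file.
-/
-- D-0017: single-problem summit, the namespace repeats the problem name by design.
set_option linter.dupNamespace false
set_option autoImplicit false

noncomputable section

open scoped Classical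

open PowerSeries NumberField IsDedekindDomain Field
open Literature.NumberTheory.EllipticCurves Literature.NumberTheory.GaloisRepresentations
open Literature.NumberTheory.EllipticCurves.IwasawaDual
open Literature.NumberTheory.EllipticCurves.AcSigned

namespace Summit.BirchSwinnertonDyer.BirchSwinnertonDyer.Theorems.SignedBaseChangeAcDivEisensteinTransferConverseXAc

/-! ## §2 The reading on `Castella2018.AcSelmer.XAc` for a base change `W⁄K`, and the equivalence -/

section Corollary

variable {K : Type} [Field K] [NumberField K] {W : WeierstrassCurve ℚ} {p : ℕ} [Fact p.Prime]
  {κ : ZpExtension K p} {γ : absoluteGaloisGroup K} [hγF : Fact (κ.IsTopGenerator γ)]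
  {𝔭 : HeightOneSpectrum (𝓞 K)} {h𝔭 : IsNonsplitIn κ 𝔭} {γ𝔭 : absoluteGaloisGroup (𝔭.adicCompletion K)}
  {hγ𝔭 : κ (resGalOfEmb (closureEmb (K := K) (𝔭.adicCompletion K)) γ𝔭) = κ γ}
  {𝔭' : HeightOneSpectrum (𝓞 K)} {h𝔭𝔭' : 𝔭 ≠ 𝔭'} {h𝔭p : ((p : ℕ) : 𝓞 K) ∈ 𝔭.asIdeal} {ε : ℤˣ}
  {z : selmerLambdaAdic (W.baseChange K) p κ γ (fun _ ↦ .sgn ε)} {L : UnrSeries p}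

set_option synthInstance.maxHeartbeats 200000 in
/-- **Form T from the rational BDP Eisenstein inclusion, in the crux's object `AcSelmer.XAc`** (`W⁄K` a
base change, `p ∈ 𝔭'`): under the forward file's hypotheses, `(p^k)·Ch_Λ(X_ac)·R₀⟦T⟧ ⊆ (L)` along ONE
compatible `j : ℤ_p → R₀` (`X_ac = AcSelmer.XAc (W⁄K) p κ 𝔭' ∅ γ`) gives the signed Heegner-side Eisenstein
inclusion `(p^k)·char(X_{ε,tors}) ⊆ ι(signedHeegnerCharIdeal hγ ε z)²` — the converse of
`SignedBaseChangeAcDivEisensteinTransfer.TransferInputs.span_pow_mul_XAc_charIdeal_map_le_span`.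
[cite: CastellaWan2023, Thm. 6.8 (MS pp. 29–31)] [cite: Castella2018, Def. 2.2 (arXiv:1704.06608 p. 5)] -/
theorem TransferInputs.formT_of_XAc_charIdeal_map_le_span [W.IsElliptic]
    (h : TransferInputs (W.baseChange K) p κ γ hγF.out 𝔭 h𝔭 γ𝔭 hγ𝔭 𝔭' h𝔭𝔭' h𝔭p ε z L)
    (h𝔭'p : ((p : ℕ) : 𝓞 K) ∈ 𝔭'.asIdeal)
    (hinj : Function.Injective
      (locSignedAt (W.baseChange K) p κ 𝔭 h𝔭 γ γ𝔭 hγ𝔭 (fun _ ↦ .sgn ε) ε rfl h𝔭p))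
    (hX : X.HasRank (W.baseChange K) p κ ∅ (fun _ ↦ .sgn ε) hγF.out 1)
    (hEq : ∀ x' : selmerLambdaAdic (W.baseChange K) p κ γ (PCond.at 𝔭' .rel (.sgn ε)),
      ∃ x : selmerLambdaAdic (W.baseChange K) p κ γ (fun _ ↦ .sgn ε),
        locSignedAt (W.baseChange K) p κ 𝔭 h𝔭 γ γ𝔭 hγ𝔭 (fun _ ↦ .sgn ε) ε rfl h𝔭p x =
          locSignedAt (W.baseChange K) p κ 𝔭 h𝔭 γ γ𝔭 hγ𝔭 (PCond.at 𝔭' .rel (.sgn ε)) ε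
            (PCond.at_of_ne .rel (.sgn ε) h𝔭𝔭') h𝔭p x')
    {k : ℕ} (j : ℤ_[p] →+* unrIntegers p)
    (hj : ∀ x : ℤ_[p], ((j x : unrIntegers p) : ℂ_[p]) = algebraMap ℚ_[p] ℂ_[p] (x : ℚ_[p]))
    (hBDP : Ideal.span {((p : ℕ) : UnrSeries p) ^ k} *
        (Castella2018.AcSelmer.XAc.charIdeal (W.baseChange K) p κ 𝔭' ∅ γ).map (PowerSeries.map j) ≤
      Ideal.span {L}) :
    Ideal.span {((p : ℕ) : IwasawaAlgebra p) ^ k} *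
        X.torsionCharIdeal (W.baseChange K) p κ ∅ (fun _ ↦ .sgn ε) hγF.out ≤
      (signedHeegnerCharIdeal hγF.out ε z).map (IwasawaAlgebra.invol p) ^ 2 := by
  rw [← X.charIdeal_at_str_rel_eq_XAc_charIdeal (W.baseChange K) p κ ∅ γ h𝔭'p] at hBDP
  exact SignedBaseChangeAcDivEisensteinTransferConverse.TransferInputs.span_pow_mul_torsionCharIdeal_le_of_map_le_span
    h hinj hX hEq j hj hBDP

set_option synthInstance.maxHeartbeats 200000 in
/-- **Castella–Wan Thm. 6.8 for the `⊆` divisibilities up to `p^k`, as an EQUIVALENCE on the tree's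
carriers**: under the standing hypotheses of the two transfer files, Form T
`∃ k, (p^k)·char(X_{ε,tors}) ⊆ ι(signedHeegnerCharIdeal hγ ε z)²` (signed Heegner side, the registered research
statement of line `bdpline`) holds iff the rational BDP Eisenstein inclusion
`∃ k, ∀ j compatible, (p^k)·Ch_Λ(X_ac)·R₀⟦T⟧ ⊆ (L)` holds (BDP side, Castella–Wan (ii) with `⊆`). Forward:
p634573; backward: this file, at any one compatible `j` (one exists: `exists_ringHom_padicInt_unrIntegers`).
[cite: CastellaWan2023, Thm. 6.8 "Conjectures 4.8 and 5.2 are equivalent … the same result holds for the opposite divisibilities" (MS pp. 29–31)] -/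
theorem TransferInputs.formT_iff_XAc_charIdeal_map_le_span [W.IsElliptic]
    (h : TransferInputs (W.baseChange K) p κ γ hγF.out 𝔭 h𝔭 γ𝔭 hγ𝔭 𝔭' h𝔭𝔭' h𝔭p ε z L)
    (h𝔭'p : ((p : ℕ) : 𝓞 K) ∈ 𝔭'.asIdeal)
    (hinj : Function.Injective
      (locSignedAt (W.baseChange K) p κ 𝔭 h𝔭 γ γ𝔭 hγ𝔭 (fun _ ↦ .sgn ε) ε rfl h𝔭p))
    (hX : X.HasRank (W.baseChange K) p κ ∅ (fun _ ↦ .sgn ε) hγF.out 1)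
    (hEq : ∀ x' : selmerLambdaAdic (W.baseChange K) p κ γ (PCond.at 𝔭' .rel (.sgn ε)),
      ∃ x : selmerLambdaAdic (W.baseChange K) p κ γ (fun _ ↦ .sgn ε),
        locSignedAt (W.baseChange K) p κ 𝔭 h𝔭 γ γ𝔭 hγ𝔭 (fun _ ↦ .sgn ε) ε rfl h𝔭p x =
          locSignedAt (W.baseChange K) p κ 𝔭 h𝔭 γ γ𝔭 hγ𝔭 (PCond.at 𝔭' .rel (.sgn ε)) ε
            (PCond.at_of_ne .rel (.sgn ε) h𝔭𝔭') h𝔭p x') :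
    (∃ k : ℕ, Ideal.span {((p : ℕ) : IwasawaAlgebra p) ^ k} *
        X.torsionCharIdeal (W.baseChange K) p κ ∅ (fun _ ↦ .sgn ε) hγF.out ≤
      (signedHeegnerCharIdeal hγF.out ε z).map (IwasawaAlgebra.invol p) ^ 2) ↔
    (∃ k : ℕ, ∀ (j : ℤ_[p] →+* unrIntegers p),
      (∀ x : ℤ_[p], ((j x : unrIntegers p) : ℂ_[p]) = algebraMap ℚ_[p] ℂ_[p] (x : ℚ_[p])) →
      Ideal.span {((p : ℕ) : UnrSeries p) ^ k} *
          (Castella2018.AcSelmer.XAc.charIdeal (W.baseChange K) p κ 𝔭' ∅ γ).map (PowerSeries.map j) ≤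
        Ideal.span {L}) := by
  constructor
  · rintro ⟨k, hk⟩
    exact ⟨k, fun j hj ↦
      SignedBaseChangeAcDivEisensteinTransfer.TransferInputs.span_pow_mul_XAc_charIdeal_map_le_span h h𝔭'p
        hinj hX hEq hk j hj⟩
  · rintro ⟨k, hk⟩
    obtain ⟨j, hj⟩ := exists_ringHom_padicInt_unrIntegers (p := p)
    exact ⟨k, TransferInputs.formT_of_XAc_charIdeal_map_le_span h h𝔭'p hinj hX hEq j hj (hk j hj)⟩

end Corollary

end Summit.BirchSwinnertonDyer.BirchSwinnertonDyer.Theorems.SignedBaseChangeAcDivEisensteinTransferConverseXAc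

end
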